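import Summits.CriticalPhenomena.PercolationContinuityZ3.Theorems.SahiAEVersion
import Literature.Probability.LatticeModels.FourFunctionsAE

/-!
# Almost-everywhere sublattices have Borel versions which are sublattices
# (the `{0,1}`-valued case of the everywhere-MTP₂-version question)

Support file of the Sahi cell (`prim-sahi`; literature seat gen34, evidence on `stmt-CriticalPhenomena-4575`,
to be landed by a prover/typer seat).  Theorems only (no definitions, no named facts, no sorries).

Context.  `Theorems/SahiAEVersion.lean` (`exists_mtp2_version_of_ae`): on a finite product `π = ⊗ᵢ ρᵢ` of finite
measures on `ℝ`, a bounded measurable `f` which is MTP₂ on `π ⊗ π`-almost every pair has a version `g = f` a.e.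
which is MTP₂ at EVERY pair — `g` an ultrafilter limit of the box ratios
`R_n(x) = (f·π)(B̄(x,r_n)) / π(B̄(x,r_n))`, `r_n = 1/(n+1)`; whether a BOREL such `g` exists was left open there
(the `limsup` / `liminf` representatives fail).  No source treats the question (cell LITERATURE.md §39:
Karlin–Rinott 1980 (1.4), Müller–Stoyan 2002 (3.10.8) and Fuchs–Wang 2026 p. 2 DEFINE MTP₂ through a version
satisfying the inequality everywhere; Batty–Bollmann 1980 handle the a.e. hypothesis at the level of the integral
inequalities).  This file settles the indicator case positively with an explicit Borel version.

For `f = 𝟙_L` the hypothesis says that `L` is an ALMOST sublattice (`x, y ∈ L ⟹ x ∧ y, x ∨ y ∈ L` for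
`π ⊗ π`-a.e. `(x, y)`), and an everywhere-MTP₂ `{0,1}`-valued version is the indicator of an honest sublattice.
Take
`L' = {x : 0 < liminf_n π(L ∩ B̄(x,r_n)) / π(B̄(x,r_n))}`,
the points of positive lower `π`-density of `L` along the radii `r_n`.  Then
* `L'` is measurable (the ratios are measurable in `x`, `Measurable.liminf`);
* `L' = L` `π`-a.e. (Besicovitch's density theorem, `Besicovitch.ae_tendsto_measure_inter_div_of_measurableSet`);
* `L'` is inf- and sup-closed: the ratio inequality `R_n(x) R_n(y) ≤ R_n(x ∧ y) R_n(x ∨ y)` of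
  `SahiAEVersion.lean` (set-TP₂ of `π|_L` from the a.e. four functions theorem + the product identity for boxes)
  together with `R_n ≤ 1` gives `R_n(x ∧ y) ≥ R_n(x) R_n(y)` and `R_n(x ∨ y) ≥ R_n(x) R_n(y)` for every `n`, and
  POSITIVITY of a `liminf` survives products — no multiplicativity of a limit is needed when only the threshold
  `> 0` is asked.  (So supports / zero sets are never the obstruction to a Borel everywhere version.)

* `ratio_mul_le_inf`, `ratio_mul_le_sup` — the one-sided ratio inequalities for `π|_L` on sup-norm balls.
* `infClosed_posLowerDensity`, `supClosed_posLowerDensity` — `L'` is a sublattice (for ANY measurable `L` whose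
  restriction `π|_L` is set-TP₂).
* `exists_measurable_sublattice_version_of_ae` — **for `L ⊆ ℝ^ι` measurable with `𝟙_L` MTP₂ on a.e. pair there
  is a measurable `L'`, `L' = L` `π`-a.e., which is inf-closed and sup-closed.** [this work]
* `exists_measurable_mtp2_version_indicator_of_ae` — the same in the shape of `exists_mtp2_version_of_ae`:
  a MEASURABLE `g = 𝟙_L` a.e., `g ≤ 1`, MTP₂ at every pair. [this work]
* `exists_measurable_sublattice_version_of_ae_volume` — Lebesgue reference measure.
The reference factors `ρᵢ` are only assumed locally finite (Lebesgue measure included).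
-/

noncomputable section

namespace Summit.CriticalPhenomena.PercolationContinuityZ3.Theorems.SahiAEFourFunctions

open MeasureTheory Set Filter Topology Metric
open Literature.Probability.LatticeModels Literature.Probability.LatticeModels.Affiliation
open Summit.CriticalPhenomena.PercolationContinuityZ3.Theorems.SahiCMTP2
open scoped ENNReal

variable {ι : Type*} [Fintype ι]

/-- Set-TP₂ on sup-norm balls: `ν(B̄(u,r)) ν(B̄(v,r)) ≤ ν(B̄(u ∧ v,r)) ν(B̄(u ∨ v,r))` (boxes are order intervals
and `B̄(u,r) ∧ B̄(v,r) ⊆ B̄(u ∧ v,r)`, `B̄(u,r) ∨ B̄(v,r) ⊆ B̄(u ∨ v,r)`). [folklore] -/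
private theorem closedBall_mul_le_of_mIsSetTP2' {ν : Measure (ι → ℝ)} (h : mIsSetTP2 ν) (u v : ι → ℝ)
    {r : ℝ} (hr : 0 ≤ r) :
    ν (closedBall u r) * ν (closedBall v r) ≤ ν (closedBall (u ⊓ v) r) * ν (closedBall (u ⊔ v) r) := by
  simp only [closedBall_eq_Icc_pi _ hr]
  have h1 := h.icc (fun i => u i - r) (fun i => u i + r) (fun i => v i - r) (fun i => v i + r)
  have e1 : ((fun i => u i - r) ⊓ fun i => v i - r) = fun i => (u ⊓ v) i - r :=
    funext fun i => min_sub_sub_right _ _ _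
  have e2 : ((fun i => u i + r) ⊓ fun i => v i + r) = fun i => (u ⊓ v) i + r :=
    funext fun i => min_add_add_right _ _ _
  have e3 : ((fun i => u i - r) ⊔ fun i => v i - r) = fun i => (u ⊔ v) i - r :=
    funext fun i => max_sub_sub_right _ _ _
  have e4 : ((fun i => u i + r) ⊔ fun i => v i + r) = fun i => (u ⊔ v) i + r :=
    funext fun i => max_add_add_right _ _ _
  rwa [e1, e2, e3, e4] at h1

/-- Measurability in the centre of `x ↦ μ (L ∩ B̄(x,r))` for an s-finite measure on `ℝ^ι` (section measure of
the measurable set `{(x,y) : y ∈ L, dist y x ≤ r}`). [folklore] -/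
private theorem measurable_measure_inter_closedBall (μ : Measure (ι → ℝ)) [SFinite μ] {L : Set (ι → ℝ)}
    (hL : MeasurableSet L) (r : ℝ) : Measurable fun x => μ (L ∩ closedBall x r) := by
  have hs : MeasurableSet {p : (ι → ℝ) × (ι → ℝ) | p.2 ∈ L ∧ dist p.2 p.1 ≤ r} :=
    (measurable_snd hL).inter (measurableSet_le (continuous_snd.dist continuous_fst).measurable measurable_const)
  have h := measurable_measure_prodMk_left (ν := μ) hs
  have e : (fun x => μ (L ∩ closedBall x r)) =
      fun x => μ (Prod.mk x ⁻¹' {p : (ι → ℝ) × (ι → ℝ) | p.2 ∈ L ∧ dist p.2 p.1 ≤ r}) := by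
    funext x
    congr 1
  rw [e]
  exact h

/-- The lower-density ratios of `L` along sup-norm balls are at most `1`. [folklore] -/
private theorem ratio_le_one (μ : Measure (ι → ℝ)) (L : Set (ι → ℝ)) (x : ι → ℝ) (r : ℝ) :
    μ (L ∩ closedBall x r) / μ (closedBall x r) ≤ 1 :=
  ENNReal.div_le_of_le_mul (by rw [one_mul]; exact measure_mono inter_subset_right)

/-- **One-sided ratio inequality at the meet.**  If `π|_L` is set-TP₂ for a finite product `π = ⊗ᵢ ρᵢ` of locally
finite measures on `ℝ`, then for all `x, y` and `r ≥ 0` the density ratios `R(z) = π(L ∩ B̄(z,r)) / π(B̄(z,r))` satisfy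
`R(x) R(y) ≤ R(x ∧ y)` (from `R(x) R(y) ≤ R(x ∧ y) R(x ∨ y)` — set-TP₂ on boxes and the product identity
`π(B̄(x,r)) π(B̄(y,r)) = π(B̄(x∧y,r)) π(B̄(x∨y,r))` — and `R ≤ 1`). [this work] -/
theorem ratio_mul_le_inf (ρ : ι → Measure ℝ) [∀ i, IsLocallyFiniteMeasure (ρ i)] {L : Set (ι → ℝ)}
    (hTP : mIsSetTP2 ((Measure.pi ρ).restrict L)) (x y : ι → ℝ) {r : ℝ} (hr : 0 ≤ r) :
    Measure.pi ρ (L ∩ closedBall x r) / Measure.pi ρ (closedBall x r) *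
        (Measure.pi ρ (L ∩ closedBall y r) / Measure.pi ρ (closedBall y r)) ≤
      Measure.pi ρ (L ∩ closedBall (x ⊓ y) r) / Measure.pi ρ (closedBall (x ⊓ y) r) := by
  set π := Measure.pi ρ with hπ
  have hres : ∀ z : ι → ℝ, π.restrict L (closedBall z r) = π (L ∩ closedBall z r) := fun z => by
    rw [Measure.restrict_apply measurableSet_closedBall, inter_comm]
  have h4 := closedBall_mul_le_of_mIsSetTP2' hTP x y hr
  simp only [hres] at h4
  have hnull : ∀ z : ι → ℝ, π (closedBall z r) = 0 → π (L ∩ closedBall z r) = 0 := fun z h0 =>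
    measure_mono_null inter_subset_right h0
  have hq := div_mul_div_le_of_mul_le h4 (pi_closedBall_mul_eq ρ x y hr) (hnull x) (hnull y)
    measure_closedBall_lt_top.ne measure_closedBall_lt_top.ne
  exact hq.trans (mul_le_of_le_one_right' (ratio_le_one π L (x ⊔ y) r))

/-- **One-sided ratio inequality at the join**: `R(x) R(y) ≤ R(x ∨ y)`. [this work] -/
theorem ratio_mul_le_sup (ρ : ι → Measure ℝ) [∀ i, IsLocallyFiniteMeasure (ρ i)] {L : Set (ι → ℝ)}
    (hTP : mIsSetTP2 ((Measure.pi ρ).restrict L)) (x y : ι → ℝ) {r : ℝ} (hr : 0 ≤ r) :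
    Measure.pi ρ (L ∩ closedBall x r) / Measure.pi ρ (closedBall x r) *
        (Measure.pi ρ (L ∩ closedBall y r) / Measure.pi ρ (closedBall y r)) ≤
      Measure.pi ρ (L ∩ closedBall (x ⊔ y) r) / Measure.pi ρ (closedBall (x ⊔ y) r) := by
  set π := Measure.pi ρ with hπ
  have hres : ∀ z : ι → ℝ, π.restrict L (closedBall z r) = π (L ∩ closedBall z r) := fun z => by
    rw [Measure.restrict_apply measurableSet_closedBall, inter_comm]
  have h4 := closedBall_mul_le_of_mIsSetTP2' hTP x y hr
  simp only [hres] at h4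
  have hnull : ∀ z : ι → ℝ, π (closedBall z r) = 0 → π (L ∩ closedBall z r) = 0 := fun z h0 =>
    measure_mono_null inter_subset_right h0
  have hq := div_mul_div_le_of_mul_le h4 (pi_closedBall_mul_eq ρ x y hr) (hnull x) (hnull y)
    measure_closedBall_lt_top.ne measure_closedBall_lt_top.ne
  exact hq.trans (mul_le_of_le_one_left' (ratio_le_one π L (x ⊓ y) r))

/-- Positivity of a `liminf` survives products: if `u_n v_n ≤ w_n` for all `n` and `liminf u, liminf v > 0` in
`[0,∞]`, then `liminf w > 0`. [folklore] -/
private theorem liminf_pos_of_mul_le {u v w : ℕ → ℝ≥0∞} (h : ∀ n, u n * v n ≤ w n)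
    (hu : 0 < liminf u atTop) (hv : 0 < liminf v atTop) : 0 < liminf w atTop := by
  obtain ⟨a, ha0, hau⟩ := exists_between hu
  obtain ⟨b, hb0, hbv⟩ := exists_between hv
  have hea : ∀ᶠ n in atTop, a < u n := eventually_lt_of_lt_liminf hau
  have heb : ∀ᶠ n in atTop, b < v n := eventually_lt_of_lt_liminf hbv
  have hev : ∀ᶠ n in atTop, a * b ≤ w n :=
    (hea.and heb).mono fun n hn => (mul_le_mul' hn.1.le hn.2.le).trans (h n)
  have hle : a * b ≤ liminf w atTop := le_liminf_of_le (by isBoundedDefault) hev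
  exact lt_of_lt_of_le (ENNReal.mul_pos ha0.ne' hb0.ne') hle

/-- **The set of points of positive lower density of `L` is inf-closed** whenever `π|_L` is set-TP₂
(`π` a finite product of locally finite measures on `ℝ`; radii `r_n = 1/(n+1)`). [this work] -/
theorem infClosed_posLowerDensity (ρ : ι → Measure ℝ) [∀ i, IsLocallyFiniteMeasure (ρ i)] {L : Set (ι → ℝ)}
    (hTP : mIsSetTP2 ((Measure.pi ρ).restrict L)) :
    InfClosed {x : ι → ℝ | 0 < liminf (fun n : ℕ => Measure.pi ρ (L ∩ closedBall x ((n : ℝ) + 1)⁻¹) /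
      Measure.pi ρ (closedBall x ((n : ℝ) + 1)⁻¹)) atTop} := by
  intro x hx y hy
  simp only [mem_setOf_eq] at hx hy ⊢
  have hrpos : ∀ n : ℕ, (0 : ℝ) ≤ ((n : ℝ) + 1)⁻¹ := fun n => by positivity
  exact liminf_pos_of_mul_le (fun n => ratio_mul_le_inf ρ hTP x y (hrpos n)) hx hy

/-- **The set of points of positive lower density of `L` is sup-closed** whenever `π|_L` is set-TP₂. [this work] -/
theorem supClosed_posLowerDensity (ρ : ι → Measure ℝ) [∀ i, IsLocallyFiniteMeasure (ρ i)] {L : Set (ι → ℝ)}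
    (hTP : mIsSetTP2 ((Measure.pi ρ).restrict L)) :
    SupClosed {x : ι → ℝ | 0 < liminf (fun n : ℕ => Measure.pi ρ (L ∩ closedBall x ((n : ℝ) + 1)⁻¹) /
      Measure.pi ρ (closedBall x ((n : ℝ) + 1)⁻¹)) atTop} := by
  intro x hx y hy
  simp only [mem_setOf_eq] at hx hy ⊢
  have hrpos : ∀ n : ℕ, (0 : ℝ) ≤ ((n : ℝ) + 1)⁻¹ := fun n => by positivity
  exact liminf_pos_of_mul_le (fun n => ratio_mul_le_sup ρ hTP x y (hrpos n)) hx hy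

/-- The points of positive lower density form a measurable set. [folklore] -/
private theorem measurableSet_posLowerDensity (ρ : ι → Measure ℝ) [∀ i, IsLocallyFiniteMeasure (ρ i)]
    {L : Set (ι → ℝ)} (hL : MeasurableSet L) :
    MeasurableSet {x : ι → ℝ | 0 < liminf (fun n : ℕ => Measure.pi ρ (L ∩ closedBall x ((n : ℝ) + 1)⁻¹) /
      Measure.pi ρ (closedBall x ((n : ℝ) + 1)⁻¹)) atTop} := by
  have hR : ∀ n : ℕ, Measurable fun x : ι → ℝ => Measure.pi ρ (L ∩ closedBall x ((n : ℝ) + 1)⁻¹) /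
      Measure.pi ρ (closedBall x ((n : ℝ) + 1)⁻¹) := fun n => by
    have h1 := measurable_measure_inter_closedBall (Measure.pi ρ) hL ((n : ℝ) + 1)⁻¹
    have h2 := measurable_measure_inter_closedBall (Measure.pi ρ) MeasurableSet.univ ((n : ℝ) + 1)⁻¹
    simp only [univ_inter] at h2
    exact h1.div h2
  exact measurableSet_lt measurable_const (Measurable.liminf hR)

/-- Almost every point of `L` has lower density `1 > 0` and almost every point off `L` has density `0`
(Besicovitch), along `r_n = 1/(n+1)`. [folklore] -/
private theorem ae_posLowerDensity_iff (ρ : ι → Measure ℝ) [∀ i, IsLocallyFiniteMeasure (ρ i)] {L : Set (ι → ℝ)}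
    (hL : MeasurableSet L) :
    ∀ᵐ x ∂Measure.pi ρ, (0 < liminf (fun n : ℕ => Measure.pi ρ (L ∩ closedBall x ((n : ℝ) + 1)⁻¹) /
      Measure.pi ρ (closedBall x ((n : ℝ) + 1)⁻¹)) atTop) ↔ x ∈ L := by
  have hrn : Tendsto (fun n : ℕ => ((n : ℝ) + 1)⁻¹) atTop (𝓝[>] 0) := by
    refine tendsto_nhdsWithin_iff.2 ⟨?_, Eventually.of_forall fun n =>
      mem_Ioi.2 (show (0 : ℝ) < ((n : ℝ) + 1)⁻¹ by positivity)⟩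
    simpa only [one_div] using tendsto_one_div_add_atTop_nhds_zero_nat (𝕜 := ℝ)
  filter_upwards [Besicovitch.ae_tendsto_measure_inter_div_of_measurableSet (Measure.pi ρ) hL] with x hx
  have h1 : Tendsto (fun n : ℕ => Measure.pi ρ (L ∩ closedBall x ((n : ℝ) + 1)⁻¹) /
      Measure.pi ρ (closedBall x ((n : ℝ) + 1)⁻¹)) atTop (𝓝 (L.indicator 1 x)) := hx.comp hrn
  rw [h1.liminf_eq]
  by_cases hxL : x ∈ L
  · simp [hxL]
  · simp [hxL]

/-- **Almost sublattices of `ℝ^ι` have measurable versions which are sublattices.**  Let `π = ⊗ᵢ ρᵢ` be a finite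
product of locally finite measures on `ℝ` (e.g. Lebesgue measure) and `L ⊆ ℝ^ι` measurable such that for `π ⊗ π`-almost every `(x, y)`,
`x ∈ L` and `y ∈ L` imply `x ∧ y ∈ L` and `x ∨ y ∈ L` (equivalently: `𝟙_L` is MTP₂ on almost every pair).  Then
there is a measurable `L'` with `L' = L` `π`-a.e. which is inf-closed and sup-closed — namely the set of points of
positive lower `π`-density of `L`. [this work] -/
theorem exists_measurable_sublattice_version_of_ae (ρ : ι → Measure ℝ) [∀ i, IsLocallyFiniteMeasure (ρ i)]
    {L : Set (ι → ℝ)} (hL : MeasurableSet L)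
    (hae : ∀ᵐ p ∂(Measure.pi ρ).prod (Measure.pi ρ), p.1 ∈ L → p.2 ∈ L → p.1 ⊓ p.2 ∈ L ∧ p.1 ⊔ p.2 ∈ L) :
    ∃ L' : Set (ι → ℝ), MeasurableSet L' ∧ (∀ᵐ x ∂Measure.pi ρ, x ∈ L' ↔ x ∈ L) ∧
      (L' : Set (ι → ℝ)) =ᵐ[Measure.pi ρ] L ∧ InfClosed L' ∧ SupClosed L' := by
  set π := Measure.pi ρ with hπ
  -- `π|_L` is set-TP₂: the a.e. four functions theorem for the weight `𝟙_L`
  have hf : Measurable (L.indicator (1 : (ι → ℝ) → ℝ≥0∞)) := measurable_one.indicator hL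
  have hMTP : ∀ᵐ p ∂π.prod π, L.indicator (1 : (ι → ℝ) → ℝ≥0∞) p.1 * L.indicator 1 p.2 ≤
      L.indicator 1 (p.1 ⊓ p.2) * L.indicator 1 (p.1 ⊔ p.2) := by
    filter_upwards [hae] with p hp
    by_cases h1 : p.1 ∈ L
    · by_cases h2 : p.2 ∈ L
      · obtain ⟨h3, h4⟩ := hp h1 h2
        simp [indicator_of_mem, h1, h2, h3, h4]
      · simp [h2]
    · simp [h1]
  have hTP : mIsSetTP2 (π.restrict L) := by
    have h := Literature.Probability.LatticeModels.Affiliation.mIsSetTP2_withDensity_pi_of_ae ρ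
      (L.indicator 1) hf hMTP
    rwa [withDensity_indicator_one hL] at h
  refine ⟨{x : ι → ℝ | 0 < liminf (fun n : ℕ => π (L ∩ closedBall x ((n : ℝ) + 1)⁻¹) /
      π (closedBall x ((n : ℝ) + 1)⁻¹)) atTop}, measurableSet_posLowerDensity ρ hL,
    ae_posLowerDensity_iff ρ hL, ?_, infClosed_posLowerDensity ρ hTP, supClosed_posLowerDensity ρ hTP⟩
  filter_upwards [ae_posLowerDensity_iff ρ hL] with x hx
  exact propext hx

/-- **The `{0,1}`-valued case of the Borel-version question, in the shape of `exists_mtp2_version_of_ae`.**  For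
`L ⊆ ℝ^ι` measurable with `𝟙_L` MTP₂ on `π ⊗ π`-almost every pair there is a MEASURABLE `g`, `g ≤ 1`, `g = 𝟙_L`
`π`-a.e., with `g(x) g(y) ≤ g(x ∧ y) g(x ∨ y)` for ALL `x, y` (namely `g = 𝟙_{L'}` for the positive-lower-density
version `L'` of `L`). [this work] -/
theorem exists_measurable_mtp2_version_indicator_of_ae (ρ : ι → Measure ℝ) [∀ i, IsLocallyFiniteMeasure (ρ i)]
    {L : Set (ι → ℝ)} (hL : MeasurableSet L)
    (hMTP : ∀ᵐ p ∂(Measure.pi ρ).prod (Measure.pi ρ), L.indicator (1 : (ι → ℝ) → ℝ≥0∞) p.1 * L.indicator 1 p.2 ≤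
      L.indicator 1 (p.1 ⊓ p.2) * L.indicator 1 (p.1 ⊔ p.2)) :
    ∃ g : (ι → ℝ) → ℝ≥0∞, Measurable g ∧ (∀ x, g x ≤ 1) ∧ g =ᵐ[Measure.pi ρ] L.indicator 1 ∧
      ∀ x y, g x * g y ≤ g (x ⊓ y) * g (x ⊔ y) := by
  -- the a.e. sublattice property from the a.e. inequality for the indicator
  have hae : ∀ᵐ p ∂(Measure.pi ρ).prod (Measure.pi ρ),
      p.1 ∈ L → p.2 ∈ L → p.1 ⊓ p.2 ∈ L ∧ p.1 ⊔ p.2 ∈ L := by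
    filter_upwards [hMTP] with p hp h1 h2
    rw [indicator_of_mem h1, indicator_of_mem h2, Pi.one_apply, one_mul] at hp
    by_contra hcon
    rw [not_and_or] at hcon
    rcases hcon with h3 | h4
    · rw [indicator_of_notMem h3, zero_mul] at hp
      exact absurd hp (not_le.2 zero_lt_one)
    · rw [indicator_of_notMem h4, mul_zero] at hp
      exact absurd hp (not_le.2 zero_lt_one)
  obtain ⟨L', hL'm, -, hL'ae, hinf, hsup⟩ := exists_measurable_sublattice_version_of_ae ρ hL hae
  refine ⟨L'.indicator 1, measurable_one.indicator hL'm, fun x => ?_, indicator_ae_eq_of_ae_eq_set hL'ae,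
    fun x y => ?_⟩
  · by_cases hx : x ∈ L'
    · simp [hx]
    · simp [hx]
  · by_cases hx : x ∈ L'
    · by_cases hy : y ∈ L'
      · simp [indicator_of_mem, hx, hy, hinf hx hy, hsup hx hy]
      · simp [hy]
    · simp [hx]

/-- **Lebesgue reference measure.**  A measurable `L ⊆ ℝ^ι` which is a sublattice up to a Lebesgue-null set of
pairs (`x, y ∈ L ⟹ x ∧ y, x ∨ y ∈ L` for a.e. `(x, y)`) coincides Lebesgue-a.e. with a measurable honest sublattice.
[this work] -/
theorem exists_measurable_sublattice_version_of_ae_volume {L : Set (ι → ℝ)} (hL : MeasurableSet L)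
    (hae : ∀ᵐ p ∂(volume : Measure (ι → ℝ)).prod volume, p.1 ∈ L → p.2 ∈ L → p.1 ⊓ p.2 ∈ L ∧ p.1 ⊔ p.2 ∈ L) :
    ∃ L' : Set (ι → ℝ), MeasurableSet L' ∧ (L' : Set (ι → ℝ)) =ᵐ[volume] L ∧ InfClosed L' ∧ SupClosed L' := by
  have hae' : ∀ᵐ p ∂(Measure.pi fun _ : ι => (volume : Measure ℝ)).prod
      (Measure.pi fun _ : ι => (volume : Measure ℝ)), p.1 ∈ L → p.2 ∈ L → p.1 ⊓ p.2 ∈ L ∧ p.1 ⊔ p.2 ∈ L := by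
    simpa only [volume_pi] using hae
  obtain ⟨L', h1, -, h2, h3, h4⟩ :=
    exists_measurable_sublattice_version_of_ae (fun _ : ι => (volume : Measure ℝ)) hL hae'
  refine ⟨L', h1, ?_, h3, h4⟩
  simpa only [volume_pi] using h2

end Summit.CriticalPhenomena.PercolationContinuityZ3.Theorems.SahiAEFourFunctions

end
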